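import Mathlib
import Summits.NavierStokesRegularity.NavierStokesRegularity.Theorems.AxisTwistDoorAveragedConeLiouvilleDefs
import Summits.NavierStokesRegularity.NavierStokesRegularity.Theorems.AxisTwistDoorAveragedConeLiouvilleProfileZoomFrame
import Summits.NavierStokesRegularity.NavierStokesRegularity.Theorems.AxisTwistDoorAveragedConeLiouvilleProfileZoomCurl
import Summits.NavierStokesRegularity.NavierStokesRegularity.Theorems.PoloidalWindowDoorPoloidalWindowRigidityClassSpaceTimeRates
import Summits.NavierStokesRegularity.NavierStokesRegularity.Theorems.LocalSineTubeDoorProfileAlignedWindowRigidityAncient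
import Literature.Analysis.FluidPDE.NSLocalLerayBackwardUniqueness
import Literature.Analysis.FluidPDE.TaoEnstrophyLocalisation
import Literature.Analysis.FluidPDE.LocalTypeICongr
import HarnessLib

/-!
# AxisTwistDoor · crux `AveragedConeLiouville` (stmt-NavierStokesRegularity-26889) · line `lrt_shell`, stub (0)
# `stub_zoomToSlackFree` — part 2b: the slack-free GLOBAL cone of the zoom limit, and the assembled stub

The circle-averaged cone hypothesis of the crux, `∮_{S(r,z)} |ω_h| r dθ ≤ K ∮_{S(r,z)} ω₃ r dθ + M r` on the unit
window (`−1 < s < 0`, `0 < r < 1`, `|z| < 1`), is read at the points `(λ_j² s, λ_j·S(r,z))` of the zooms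
`λ_j² curl v(λ_j² s)(λ_j ·)` of a class profile into its singular origin: after the change of variables it says
`∮ |ω_h(zoom_j)| r ≤ K ∮ ω₃(zoom_j) r + M λ_j² r`, and the slack `M λ_j² r` dies as `λ_j → 0`.  The two circle
integrals pass to the limit profile `v₁` by dominated convergence, the domination being the UNIVERSAL class
gradient rate `‖Dv(t)‖ ≤ K_d/(−t)` (`…ClassSpaceTimeRates.exists_fderiv_rate_of_class'`), which is scale
invariant and hence uniform along the zoom sequence; the pointwise convergence of the zoomed vorticities is part
2a (`profileZoom_curl_tendsto`).

* `globalCone_of_profileZoom` — the passage to the limit (this file's analytic content).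
* `zoomToSlackFree` — **the registered stub (0) `StubZoomToSlackFree` of `Lines/lrt_shell.lean`, VERBATIM**
  (`…AxisTwistDoorAveragedConeLiouvilleDefs.StubZoomToSlackFree`), assembled from part 1 (`profileZoomFrame`),
  part 2a (`profileZoom_curl_tendsto`, `inner_curl_nonneg_of_profileZoom`) and part 2b, with the slab data
  (suitability, weak gradient, `𝐈 < ∞`) moved from the `L³_loc` limit `w` to its continuous representative `v₁`
  by a.e. invariance.

WHAT THIS IS NOT: not a statement about Navier–Stokes regularity; a compactness step about HYPOTHETICAL Type-I
blow-up profiles (the crux `AveragedConeLiouville`, item 26991 and the leaf remain open).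
[cite: AlbrittonBarker2019, §2–3; KochNadirashviliSereginSverak2009, §4–6]
-/

noncomputable section

-- the summit and its single sub-problem share the name (CONVENTIONS §1), as in every Theorems file
set_option linter.dupNamespace false

namespace Summit.NavierStokesRegularity.NavierStokesRegularity.Theorems.AveragedConeLiouvilleProfileZoom

open MeasureTheory Set Function Filter Topology TopologicalSpace Metric
open Literature.Analysis Literature.Analysis.FluidPDE Literature.Analysis.FluidPDE.SereginSverak2009
open Summit.NavierStokesRegularity.NavierStokesRegularity.Theorems
open Summit.NavierStokesRegularity.NavierStokesRegularity.Theorems.LocalSineTubeDoorProfileAlignedWindowRigidityAncient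
open Summit.NavierStokesRegularity.NavierStokesRegularity.Theorems.PoloidalWindowDoorPoloidalWindowRigidityClassSpaceTimeRates
open scoped NNReal ENNReal RealInnerProductSpace InnerProductSpace

/-! ### elementary identities on circles about the vertical axis -/

/-- Dilating a point of the circle `S(r,z)` by `μ` gives the corresponding point of `S(μr, μz)`. -/
theorem smul_cylPoint (μ r θ z : ℝ) :
    μ • (WithLp.toLp 2 ![r * Real.cos θ, r * Real.sin θ, z] : EuclideanSpace ℝ (Fin 3)) =
      WithLp.toLp 2 ![μ * r * Real.cos θ, μ * r * Real.sin θ, μ * z] := by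
  rw [← WithLp.toLp_smul]
  congr 1
  funext i
  fin_cases i <;> simp [mul_assoc]

/-- The circle `θ ↦ (r cos θ, r sin θ, z)` is continuous. -/
theorem continuous_cylPoint (r z : ℝ) :
    Continuous fun θ : ℝ => (WithLp.toLp 2 ![r * Real.cos θ, r * Real.sin θ, z] : EuclideanSpace ℝ (Fin 3)) := by
  refine (PiLp.continuous_toLp 2 _).comp ?_
  refine continuous_pi fun i => ?_
  fin_cases i <;> simp <;> fun_prop

/-- The horizontal part commutes with scalars: `μa − ⟪μa, e⟫e = μ(a − ⟪a, e⟫e)`. -/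
theorem horizontal_smul (a e : EuclideanSpace ℝ (Fin 3)) (μ : ℝ) :
    μ • a - ⟪μ • a, e⟫_ℝ • e = μ • (a - ⟪a, e⟫_ℝ • e) := by
  rw [real_inner_smul_left, smul_sub, smul_smul]

/-- `‖a − ⟪a, e₃⟫e₃‖ ≤ 2‖a‖`. -/
theorem norm_horizontal_le (a : EuclideanSpace ℝ (Fin 3)) :
    ‖a - ⟪a, EuclideanSpace.single (2 : Fin 3) (1 : ℝ)⟫_ℝ • EuclideanSpace.single (2 : Fin 3) (1 : ℝ)‖ ≤ 2 * ‖a‖ := by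
  have he : ‖(EuclideanSpace.single (2 : Fin 3) (1 : ℝ) : EuclideanSpace ℝ (Fin 3))‖ = 1 := by
    simp
  calc ‖a - ⟪a, EuclideanSpace.single (2 : Fin 3) (1 : ℝ)⟫_ℝ • EuclideanSpace.single (2 : Fin 3) (1 : ℝ)‖
      ≤ ‖a‖ + ‖⟪a, EuclideanSpace.single (2 : Fin 3) (1 : ℝ)⟫_ℝ • (EuclideanSpace.single (2 : Fin 3) (1 : ℝ) : EuclideanSpace ℝ (Fin 3))‖ :=
        norm_sub_le _ _
    _ ≤ ‖a‖ + ‖a‖ := by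
        rw [norm_smul, he, mul_one, Real.norm_eq_abs]
        gcongr
        calc |⟪a, EuclideanSpace.single (2 : Fin 3) (1 : ℝ)⟫_ℝ|
            ≤ ‖a‖ * ‖(EuclideanSpace.single (2 : Fin 3) (1 : ℝ) : EuclideanSpace ℝ (Fin 3))‖ := abs_real_inner_le_norm _ _
          _ = ‖a‖ := by rw [he, mul_one]
    _ = 2 * ‖a‖ := by ring

/-- `|⟪a, e₃⟫| ≤ ‖a‖`. -/
theorem abs_inner_e3_le (a : EuclideanSpace ℝ (Fin 3)) :
    |⟪a, EuclideanSpace.single (2 : Fin 3) (1 : ℝ)⟫_ℝ| ≤ ‖a‖ := by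
  have he : ‖(EuclideanSpace.single (2 : Fin 3) (1 : ℝ) : EuclideanSpace ℝ (Fin 3))‖ = 1 := by
    simp
  calc |⟪a, EuclideanSpace.single (2 : Fin 3) (1 : ℝ)⟫_ℝ|
      ≤ ‖a‖ * ‖(EuclideanSpace.single (2 : Fin 3) (1 : ℝ) : EuclideanSpace ℝ (Fin 3))‖ := abs_real_inner_le_norm _ _
    _ = ‖a‖ := by rw [he, mul_one]

/-! ### part 2b: the slack-free global cone of the zoom limit -/

/-- **Abstract passage to the limit in a coned pair of circle integrals.**  If `F_j → F_∞` and `G_j → G_∞`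
pointwise on the circle, all `F_j, G_j` continuous and uniformly bounded, and `∮ F_j ≤ K ∮ G_j + ε_j` for `j` large
with `ε_j → 0`, then `∮ F_∞ ≤ K ∮ G_∞` (dominated convergence on `[0, 2π]`). -/
theorem circleIntegral_limit_le {F G : ℕ → ℝ → ℝ} {Fi Gi : ℝ → ℝ} {B K : ℝ} {ε : ℕ → ℝ}
    (hFm : ∀ j, Continuous (F j)) (hGm : ∀ j, Continuous (G j))
    (hFb : ∀ j θ, |F j θ| ≤ B) (hGb : ∀ j θ, |G j θ| ≤ B)
    (hFl : ∀ θ, Tendsto (fun j => F j θ) atTop (𝓝 (Fi θ)))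
    (hGl : ∀ θ, Tendsto (fun j => G j θ) atTop (𝓝 (Gi θ)))
    (hε : Tendsto ε atTop (𝓝 0))
    (hineq : ∀ᶠ j in atTop, ∫ θ in (0 : ℝ)..(2 * Real.pi), F j θ ≤ K * (∫ θ in (0 : ℝ)..(2 * Real.pi), G j θ) + ε j) :
    ∫ θ in (0 : ℝ)..(2 * Real.pi), Fi θ ≤ K * (∫ θ in (0 : ℝ)..(2 * Real.pi), Gi θ) := by
  have hIF : Tendsto (fun j => ∫ θ in (0 : ℝ)..(2 * Real.pi), F j θ) atTop
      (𝓝 (∫ θ in (0 : ℝ)..(2 * Real.pi), Fi θ)) :=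
    intervalIntegral.tendsto_integral_filter_of_dominated_convergence (fun _ => B)
      (Eventually.of_forall fun j => (hFm j).aestronglyMeasurable)
      (Eventually.of_forall fun j => ae_of_all _ fun θ _ => by rw [Real.norm_eq_abs]; exact hFb j θ)
      intervalIntegrable_const (ae_of_all _ fun θ _ => hFl θ)
  have hIG : Tendsto (fun j => ∫ θ in (0 : ℝ)..(2 * Real.pi), G j θ) atTop
      (𝓝 (∫ θ in (0 : ℝ)..(2 * Real.pi), Gi θ)) :=
    intervalIntegral.tendsto_integral_filter_of_dominated_convergence (fun _ => B)
      (Eventually.of_forall fun j => (hGm j).aestronglyMeasurable)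
      (Eventually.of_forall fun j => ae_of_all _ fun θ _ => by rw [Real.norm_eq_abs]; exact hGb j θ)
      intervalIntegrable_const (ae_of_all _ fun θ _ => hGl θ)
  have hlim2 : Tendsto (fun j => K * (∫ θ in (0 : ℝ)..(2 * Real.pi), G j θ) + ε j) atTop
      (𝓝 (K * (∫ θ in (0 : ℝ)..(2 * Real.pi), Gi θ) + 0)) := (hIG.const_mul K).add hε
  rw [add_zero] at hlim2
  exact le_of_tendsto_of_tendsto hIF hlim2 hineq

/-- **Scale invariance of the gradient rate**: `‖λ² curl v(λ²s)(y)‖ ≤ ‖curlCLM‖ K_d/(−s)` for every `y`, uniformly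
in `λ > 0`, when `‖Dv(t)‖ ≤ K_d/(−t)`. -/
theorem norm_zoomCurl_le {v : ℝ → EuclideanSpace ℝ (Fin 3) → EuclideanSpace ℝ (Fin 3)} {Kd : ℝ}
    (hgrad : ∀ t < 0, ∀ y, ‖fderiv ℝ (v t) y‖ ≤ Kd / (-t)) {s : ℝ} (hs : s < 0) {μ : ℝ} (hμ : 0 < μ)
    (y : EuclideanSpace ℝ (Fin 3)) : ‖μ ^ 2 • curl (v (μ ^ 2 * s)) y‖ ≤ ‖curlCLM‖ * Kd / (-s) := by
  have hl2 : 0 < μ ^ 2 := pow_pos hμ 2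
  have hs' : μ ^ 2 * s < 0 := mul_neg_of_pos_of_neg hl2 hs
  have hms : 0 < -s := neg_pos.2 hs
  have h1 := norm_curl_le (v (μ ^ 2 * s)) y
  have h2 := hgrad _ hs' y
  rw [norm_smul, Real.norm_eq_abs, abs_of_pos hl2]
  calc μ ^ 2 * ‖curl (v (μ ^ 2 * s)) y‖
      ≤ μ ^ 2 * (‖curlCLM‖ * (Kd / -(μ ^ 2 * s))) := by
        gcongr
        exact h1.trans (mul_le_mul_of_nonneg_left h2 (norm_nonneg curlCLM))
    _ = ‖curlCLM‖ * Kd / (-s) := by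
        field_simp

/-- **The slack dies in the zoom.**  Let `v` have continuous vorticity slices and the scale-invariant gradient rate
`‖Dv(t)(y)‖ ≤ K_d/(−t)` (`t < 0`), let `λ_j → 0⁺`, and suppose the zoomed vorticities converge pointwise,
`λ_j² curl v(λ_j² s)(λ_j y) → curl v₁(s)(y)` for all `s < 0`, `y`.  If `v` satisfies the circle-averaged cone WITH
slack `M r` on the unit window, then `v₁` satisfies the SLACK-FREE cone with the same `K` on every circle `S(r,z)`,
`r > 0`, at every `s < 0` (change of variables on the circles, dominated convergence with the uniform bound
`2‖curlCLM‖K_d r/(−s)`, and `M λ_j² r → 0`). -/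
theorem globalCone_of_profileZoom
    {v v₁ : ℝ → EuclideanSpace ℝ (Fin 3) → EuclideanSpace ℝ (Fin 3)} {lam : ℕ → ℝ}
    (hlam : ∀ j, 0 < lam j) (hlam0 : Tendsto lam atTop (𝓝 0))
    (hzoom : ∀ s < 0, ∀ y, Tendsto (fun j => (lam j) ^ 2 • curl (v ((lam j) ^ 2 * s)) ((lam j) • y)) atTop
      (𝓝 (curl (v₁ s) y)))
    (hcurl : ∀ t < 0, Continuous (curl (v t)))
    {Kd : ℝ} (hgrad : ∀ t < 0, ∀ y, ‖fderiv ℝ (v t) y‖ ≤ Kd / (-t))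
    {K M : ℝ}
    (hKM : ∀ s : ℝ, -1 < s → s < 0 → ∀ r : ℝ, 0 < r → r < 1 → ∀ z : ℝ, |z| < 1 →
      ∫ θ in (0 : ℝ)..(2 * Real.pi), ‖curl (v s) (WithLp.toLp 2 ![r * Real.cos θ, r * Real.sin θ, z] : EuclideanSpace ℝ (Fin 3)) -
        ⟪curl (v s) (WithLp.toLp 2 ![r * Real.cos θ, r * Real.sin θ, z] : EuclideanSpace ℝ (Fin 3)),
          (EuclideanSpace.single (2 : Fin 3) (1 : ℝ))⟫_ℝ • (EuclideanSpace.single (2 : Fin 3) (1 : ℝ))‖ * r ≤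
      K * (∫ θ in (0 : ℝ)..(2 * Real.pi), ⟪curl (v s) (WithLp.toLp 2 ![r * Real.cos θ, r * Real.sin θ, z] : EuclideanSpace ℝ (Fin 3)),
          (EuclideanSpace.single (2 : Fin 3) (1 : ℝ))⟫_ℝ * r) + M * r)
    (s : ℝ) (hs : s < 0) (r : ℝ) (hr : 0 < r) (z : ℝ) :
    (∫ θ in (0 : ℝ)..(2 * Real.pi), ‖curl (v₁ s) (WithLp.toLp 2 ![r * Real.cos θ, r * Real.sin θ, z] : EuclideanSpace ℝ (Fin 3)) -
        ⟪curl (v₁ s) (WithLp.toLp 2 ![r * Real.cos θ, r * Real.sin θ, z] : EuclideanSpace ℝ (Fin 3)),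
          (EuclideanSpace.single (2 : Fin 3) (1 : ℝ))⟫_ℝ • (EuclideanSpace.single (2 : Fin 3) (1 : ℝ))‖ * r) ≤
      K * (∫ θ in (0 : ℝ)..(2 * Real.pi), ⟪curl (v₁ s) (WithLp.toLp 2 ![r * Real.cos θ, r * Real.sin θ, z] : EuclideanSpace ℝ (Fin 3)),
          (EuclideanSpace.single (2 : Fin 3) (1 : ℝ))⟫_ℝ * r) := by
  have hms : 0 < -s := neg_pos.2 hs
  have hs' : ∀ j, (lam j) ^ 2 * s < 0 := fun j => mul_neg_of_pos_of_neg (pow_pos (hlam j) 2) hs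
  have hcyl : Continuous fun θ : ℝ =>
      (WithLp.toLp 2 ![r * Real.cos θ, r * Real.sin θ, z] : EuclideanSpace ℝ (Fin 3)) := continuous_cylPoint r z
  -- the zoomed vorticity on the circle is continuous in `θ` and uniformly bounded in `j`
  have ha : ∀ j, Continuous fun θ : ℝ => (lam j) ^ 2 • curl (v ((lam j) ^ 2 * s))
      ((lam j) • (WithLp.toLp 2 ![r * Real.cos θ, r * Real.sin θ, z] : EuclideanSpace ℝ (Fin 3))) := by
    intro j
    have h1 : Continuous fun θ : ℝ => curl (v ((lam j) ^ 2 * s))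
        ((lam j) • (WithLp.toLp 2 ![r * Real.cos θ, r * Real.sin θ, z] : EuclideanSpace ℝ (Fin 3))) :=
      (hcurl _ (hs' j)).comp (hcyl.const_smul (lam j))
    exact h1.const_smul ((lam j) ^ 2)
  have hB0 : 0 ≤ ‖curlCLM‖ * Kd / (-s) :=
    (norm_nonneg _).trans (norm_zoomCurl_le hgrad hs (hlam 0) (0 : EuclideanSpace ℝ (Fin 3)))
  have hFm : ∀ j : ℕ, Continuous fun θ : ℝ => ‖(lam j) ^ 2 • curl (v ((lam j) ^ 2 * s))
        ((lam j) • (WithLp.toLp 2 ![r * Real.cos θ, r * Real.sin θ, z] : EuclideanSpace ℝ (Fin 3))) -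
      ⟪(lam j) ^ 2 • curl (v ((lam j) ^ 2 * s))
        ((lam j) • (WithLp.toLp 2 ![r * Real.cos θ, r * Real.sin θ, z] : EuclideanSpace ℝ (Fin 3))),
        (EuclideanSpace.single (2 : Fin 3) (1 : ℝ))⟫_ℝ • (EuclideanSpace.single (2 : Fin 3) (1 : ℝ))‖ * r := by
    intro j
    have h1 : Continuous fun θ : ℝ => ⟪(lam j) ^ 2 • curl (v ((lam j) ^ 2 * s))
        ((lam j) • (WithLp.toLp 2 ![r * Real.cos θ, r * Real.sin θ, z] : EuclideanSpace ℝ (Fin 3))),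
        (EuclideanSpace.single (2 : Fin 3) (1 : ℝ))⟫_ℝ := (ha j).inner continuous_const
    have h2 : Continuous fun θ : ℝ => ⟪(lam j) ^ 2 • curl (v ((lam j) ^ 2 * s))
        ((lam j) • (WithLp.toLp 2 ![r * Real.cos θ, r * Real.sin θ, z] : EuclideanSpace ℝ (Fin 3))),
        (EuclideanSpace.single (2 : Fin 3) (1 : ℝ))⟫_ℝ • ((EuclideanSpace.single (2 : Fin 3) (1 : ℝ)) : EuclideanSpace ℝ (Fin 3)) := h1.smul continuous_const
    exact ((ha j).sub h2).norm.mul continuous_const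
  have hGm : ∀ j : ℕ, Continuous fun θ : ℝ => ⟪(lam j) ^ 2 • curl (v ((lam j) ^ 2 * s))
        ((lam j) • (WithLp.toLp 2 ![r * Real.cos θ, r * Real.sin θ, z] : EuclideanSpace ℝ (Fin 3))),
        (EuclideanSpace.single (2 : Fin 3) (1 : ℝ))⟫_ℝ * r := fun j =>
    ((ha j).inner continuous_const).mul continuous_const
  have hFb : ∀ (j : ℕ) (θ : ℝ), |‖(lam j) ^ 2 • curl (v ((lam j) ^ 2 * s))
        ((lam j) • (WithLp.toLp 2 ![r * Real.cos θ, r * Real.sin θ, z] : EuclideanSpace ℝ (Fin 3))) -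
      ⟪(lam j) ^ 2 • curl (v ((lam j) ^ 2 * s))
        ((lam j) • (WithLp.toLp 2 ![r * Real.cos θ, r * Real.sin θ, z] : EuclideanSpace ℝ (Fin 3))),
        (EuclideanSpace.single (2 : Fin 3) (1 : ℝ))⟫_ℝ • (EuclideanSpace.single (2 : Fin 3) (1 : ℝ))‖ * r| ≤ 2 * (‖curlCLM‖ * Kd / (-s)) * r := by
    intro j θ
    rw [abs_of_nonneg (mul_nonneg (norm_nonneg _) hr.le)]
    gcongr
    exact (norm_horizontal_le _).trans (by gcongr; exact norm_zoomCurl_le hgrad hs (hlam j) _)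
  have hGb : ∀ (j : ℕ) (θ : ℝ), |⟪(lam j) ^ 2 • curl (v ((lam j) ^ 2 * s))
        ((lam j) • (WithLp.toLp 2 ![r * Real.cos θ, r * Real.sin θ, z] : EuclideanSpace ℝ (Fin 3))),
        (EuclideanSpace.single (2 : Fin 3) (1 : ℝ))⟫_ℝ * r| ≤ 2 * (‖curlCLM‖ * Kd / (-s)) * r := by
    intro j θ
    rw [abs_mul, abs_of_pos hr]
    gcongr
    calc _ ≤ _ := abs_inner_e3_le _
      _ ≤ ‖curlCLM‖ * Kd / (-s) := norm_zoomCurl_le hgrad hs (hlam j) _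
      _ ≤ 2 * (‖curlCLM‖ * Kd / (-s)) := by linarith
  have hFl : ∀ θ : ℝ, Tendsto (fun j : ℕ => ‖(lam j) ^ 2 • curl (v ((lam j) ^ 2 * s))
        ((lam j) • (WithLp.toLp 2 ![r * Real.cos θ, r * Real.sin θ, z] : EuclideanSpace ℝ (Fin 3))) -
      ⟪(lam j) ^ 2 • curl (v ((lam j) ^ 2 * s))
        ((lam j) • (WithLp.toLp 2 ![r * Real.cos θ, r * Real.sin θ, z] : EuclideanSpace ℝ (Fin 3))),
        (EuclideanSpace.single (2 : Fin 3) (1 : ℝ))⟫_ℝ • (EuclideanSpace.single (2 : Fin 3) (1 : ℝ))‖ * r) atTop (𝓝 (‖curl (v₁ s) (WithLp.toLp 2 ![r * Real.cos θ, r * Real.sin θ, z] : EuclideanSpace ℝ (Fin 3)) -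
        ⟪curl (v₁ s) (WithLp.toLp 2 ![r * Real.cos θ, r * Real.sin θ, z] : EuclideanSpace ℝ (Fin 3)), (EuclideanSpace.single (2 : Fin 3) (1 : ℝ))⟫_ℝ • (EuclideanSpace.single (2 : Fin 3) (1 : ℝ))‖ * r)) := by
    intro θ
    have h := hzoom s hs (WithLp.toLp 2 ![r * Real.cos θ, r * Real.sin θ, z] : EuclideanSpace ℝ (Fin 3))
    have h1 : Tendsto (fun j : ℕ => ⟪(lam j) ^ 2 • curl (v ((lam j) ^ 2 * s))
        ((lam j) • (WithLp.toLp 2 ![r * Real.cos θ, r * Real.sin θ, z] : EuclideanSpace ℝ (Fin 3))),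
        (EuclideanSpace.single (2 : Fin 3) (1 : ℝ))⟫_ℝ) atTop (𝓝 (⟪curl (v₁ s) (WithLp.toLp 2 ![r * Real.cos θ, r * Real.sin θ, z] : EuclideanSpace ℝ (Fin 3)), (EuclideanSpace.single (2 : Fin 3) (1 : ℝ))⟫_ℝ)) := h.inner tendsto_const_nhds
    have h2 : Tendsto (fun j : ℕ => ⟪(lam j) ^ 2 • curl (v ((lam j) ^ 2 * s))
        ((lam j) • (WithLp.toLp 2 ![r * Real.cos θ, r * Real.sin θ, z] : EuclideanSpace ℝ (Fin 3))),
        (EuclideanSpace.single (2 : Fin 3) (1 : ℝ))⟫_ℝ • ((EuclideanSpace.single (2 : Fin 3) (1 : ℝ)) : EuclideanSpace ℝ (Fin 3))) atTop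
        (𝓝 (⟪curl (v₁ s) (WithLp.toLp 2 ![r * Real.cos θ, r * Real.sin θ, z] : EuclideanSpace ℝ (Fin 3)), (EuclideanSpace.single (2 : Fin 3) (1 : ℝ))⟫_ℝ • ((EuclideanSpace.single (2 : Fin 3) (1 : ℝ)) : EuclideanSpace ℝ (Fin 3)))) := h1.smul tendsto_const_nhds
    exact ((h.sub h2).norm).mul tendsto_const_nhds
  have hGl : ∀ θ : ℝ, Tendsto (fun j : ℕ => ⟪(lam j) ^ 2 • curl (v ((lam j) ^ 2 * s))
        ((lam j) • (WithLp.toLp 2 ![r * Real.cos θ, r * Real.sin θ, z] : EuclideanSpace ℝ (Fin 3))),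
        (EuclideanSpace.single (2 : Fin 3) (1 : ℝ))⟫_ℝ * r) atTop (𝓝 (⟪curl (v₁ s) (WithLp.toLp 2 ![r * Real.cos θ, r * Real.sin θ, z] : EuclideanSpace ℝ (Fin 3)), (EuclideanSpace.single (2 : Fin 3) (1 : ℝ))⟫_ℝ * r)) := by
    intro θ
    exact ((hzoom s hs (WithLp.toLp 2 ![r * Real.cos θ, r * Real.sin θ, z] : EuclideanSpace ℝ (Fin 3))).inner tendsto_const_nhds).mul tendsto_const_nhds
  have hε : Tendsto (fun j : ℕ => M * ((lam j) ^ 2 * r)) atTop (𝓝 0) := by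
    have h : Tendsto (fun j => M * ((lam j) ^ 2 * r)) atTop (𝓝 (M * (0 ^ 2 * r))) :=
      ((hlam0.pow 2).mul_const r).const_mul M
    rwa [zero_pow two_ne_zero, zero_mul, mul_zero] at h
  -- the cone WITH slack along the sequence, for `j` large: the hypothesis at the dilated data
  have hineq : ∀ᶠ j : ℕ in atTop, ∫ θ in (0 : ℝ)..(2 * Real.pi), ‖(lam j) ^ 2 • curl (v ((lam j) ^ 2 * s))
        ((lam j) • (WithLp.toLp 2 ![r * Real.cos θ, r * Real.sin θ, z] : EuclideanSpace ℝ (Fin 3))) -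
      ⟪(lam j) ^ 2 • curl (v ((lam j) ^ 2 * s))
        ((lam j) • (WithLp.toLp 2 ![r * Real.cos θ, r * Real.sin θ, z] : EuclideanSpace ℝ (Fin 3))),
        (EuclideanSpace.single (2 : Fin 3) (1 : ℝ))⟫_ℝ • (EuclideanSpace.single (2 : Fin 3) (1 : ℝ))‖ * r ≤
      K * (∫ θ in (0 : ℝ)..(2 * Real.pi), ⟪(lam j) ^ 2 • curl (v ((lam j) ^ 2 * s))
        ((lam j) • (WithLp.toLp 2 ![r * Real.cos θ, r * Real.sin θ, z] : EuclideanSpace ℝ (Fin 3))),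
        (EuclideanSpace.single (2 : Fin 3) (1 : ℝ))⟫_ℝ * r) + M * ((lam j) ^ 2 * r) := by
    have hev1 : ∀ᶠ j in atTop, (lam j) ^ 2 * (-s) < 1 := by
      have h : Tendsto (fun j => (lam j) ^ 2 * (-s)) atTop (𝓝 (0 ^ 2 * (-s))) := (hlam0.pow 2).mul_const _
      rw [zero_pow two_ne_zero, zero_mul] at h
      exact h.eventually (gt_mem_nhds one_pos)
    have hev2 : ∀ᶠ j in atTop, lam j * r < 1 := by
      have h : Tendsto (fun j => lam j * r) atTop (𝓝 (0 * r)) := hlam0.mul_const _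
      rw [zero_mul] at h
      exact h.eventually (gt_mem_nhds one_pos)
    have hev3 : ∀ᶠ j in atTop, |lam j * z| < 1 := by
      have h : Tendsto (fun j => |lam j * z|) atTop (𝓝 (|0 * z|)) := (hlam0.mul_const _).abs
      rw [zero_mul, abs_zero] at h
      exact h.eventually (gt_mem_nhds one_pos)
    filter_upwards [hev1, hev2, hev3] with j h1 h2 h3
    have hl : 0 < lam j := hlam j
    have h := hKM ((lam j) ^ 2 * s) (by linarith) (hs' j) (lam j * r) (mul_pos hl hr) h2 (lam j * z) h3
    -- change of variables on the circle
    have hFj : (fun θ : ℝ => ‖(lam j) ^ 2 • curl (v ((lam j) ^ 2 * s))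
        ((lam j) • (WithLp.toLp 2 ![r * Real.cos θ, r * Real.sin θ, z] : EuclideanSpace ℝ (Fin 3))) -
      ⟪(lam j) ^ 2 • curl (v ((lam j) ^ 2 * s))
        ((lam j) • (WithLp.toLp 2 ![r * Real.cos θ, r * Real.sin θ, z] : EuclideanSpace ℝ (Fin 3))),
        (EuclideanSpace.single (2 : Fin 3) (1 : ℝ))⟫_ℝ • (EuclideanSpace.single (2 : Fin 3) (1 : ℝ))‖ * r) =
        fun θ => lam j * (‖curl (v ((lam j) ^ 2 * s)) (WithLp.toLp 2 ![lam j * r * Real.cos θ, lam j * r * Real.sin θ, lam j * z] : EuclideanSpace ℝ (Fin 3)) -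
          ⟪curl (v ((lam j) ^ 2 * s)) (WithLp.toLp 2 ![lam j * r * Real.cos θ, lam j * r * Real.sin θ, lam j * z] : EuclideanSpace ℝ (Fin 3)), (EuclideanSpace.single (2 : Fin 3) (1 : ℝ))⟫_ℝ • (EuclideanSpace.single (2 : Fin 3) (1 : ℝ))‖ * (lam j * r)) := by
      funext θ
      rw [horizontal_smul, norm_smul, Real.norm_eq_abs, abs_of_pos (pow_pos hl 2), smul_cylPoint]
      ring
    have hGj : (fun θ : ℝ => ⟪(lam j) ^ 2 • curl (v ((lam j) ^ 2 * s))
        ((lam j) • (WithLp.toLp 2 ![r * Real.cos θ, r * Real.sin θ, z] : EuclideanSpace ℝ (Fin 3))),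
        (EuclideanSpace.single (2 : Fin 3) (1 : ℝ))⟫_ℝ * r) =
        fun θ => lam j * (⟪curl (v ((lam j) ^ 2 * s)) (WithLp.toLp 2 ![lam j * r * Real.cos θ, lam j * r * Real.sin θ, lam j * z] : EuclideanSpace ℝ (Fin 3)), (EuclideanSpace.single (2 : Fin 3) (1 : ℝ))⟫_ℝ * (lam j * r)) := by
      funext θ
      rw [real_inner_smul_left, smul_cylPoint]
      ring
    rw [hFj, hGj, intervalIntegral.integral_const_mul, intervalIntegral.integral_const_mul]
    calc lam j * _ ≤ lam j * (K * _ + M * (lam j * r)) := mul_le_mul_of_nonneg_left h hl.le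
      _ = K * (lam j * _) + M * ((lam j) ^ 2 * r) := by ring
  exact circleIntegral_limit_le hFm hGm hFb hGb hFl hGl hε hineq

/-! ### the registered stub (0), assembled -/

/-- **Stub (0) `stub_zoomToSlackFree : StubZoomToSlackFree` of `Cruxes/AveragedConeLiouville/Lines/lrt_shell.lean`**
(the type of this declaration is literally `…AxisTwistDoorAveragedConeLiouvilleDefs.StubZoomToSlackFree`).  ZOOM TO A
SLACK-FREE, GLOBALLY CONED, STILL-SINGULAR CLASS PROFILE: an energy-class profile (Type-I rate `C`, continuous,
unit-viscosity Oseen-mild, divergence-free, slab-suitable with weak gradient and `𝐈 < ∞`) with `ω₃ ≥ 0`, the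
circle-averaged cone with slack on the unit window, and a singular origin is zoomed into its origin INSIDE the class:
part 1 (`profileZoomFrame`) extracts the `L³_loc` limit `w` of `λ_j v(λ_j² ·, λ_j ·)`, slab-suitable, with `𝐈 < ∞`,
backward-singular at the apex (persistence of singularities), together with its continuous class representative
`v₁` (same rate `C`); part 2a (`profileZoom_curl_tendsto`) gives pointwise convergence of the zoomed vorticities on
every slice `s < 0`, whence the sign passes (`inner_curl_nonneg_of_profileZoom`); part 2b
(`globalCone_of_profileZoom`) kills the slack, the domination coming from the universal class gradient rate
(`exists_fderiv_rate_of_class'`); the slab data move from `w` to `v₁` by a.e. invariance.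
[cite: AlbrittonBarker2019, §2–3; KochNadirashviliSereginSverak2009, §4–6] -/
theorem zoomToSlackFree : AxisTwistDoorAveragedConeLiouvilleDefs.StubZoomToSlackFree := by
  intro C v π H hdecay hcont hmild hdiv hsw hwg hI hnn hKM hsing
  have hC : 0 ≤ C := by
    have h := hdecay (-1) (by norm_num) 0
    rw [neg_neg, Real.sqrt_one, div_one] at h
    exact (norm_nonneg _).trans h
  obtain ⟨πn, lam, w, v₁, ϖ, H', Ks, r₁, -, hlam, hlam0, hball1, hr₁, hr₁1, hKs, hL3, ⟨hsw', hwg', hI', -⟩, hae,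
    hP, hsing₁⟩ := profileZoomFrame hC hdecay hsw hwg hI hsing
  -- pointwise convergence of the zoomed vorticities (part 2a)
  have hzoom : ∀ s < 0, ∀ y, Tendsto (fun j => (lam j) ^ 2 • curl (v ((lam j) ^ 2 * s)) ((lam j) • y)) atTop
      (𝓝 (curl (v₁ s) y)) :=
    fun s hs y => profileZoom_curl_tendsto hdecay hcont hball1 hlam hlam0 hr₁ hr₁1 hKs hL3 hae hP s hs y
  -- the slab data pass from `w` to its a.e.-equal continuous representative `v₁`
  have hae' : ∀ᵐ x ∂(volume.restrict ((slab (EuclideanSpace ℝ (Fin 3)) (Iio 0) isOpen_Iio :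
      TopologicalSpace.Opens (ℝ × (EuclideanSpace ℝ (Fin 3)))) : Set (ℝ × (EuclideanSpace ℝ (Fin 3))))),
      uncurry w x = uncurry v₁ x := by
    rw [coe_slab]
    exact hae
  have hsw₁ : IsSuitableWeakSolutionOn (slab (EuclideanSpace ℝ (Fin 3)) (Iio 0) isOpen_Iio) 1 0 v₁ ϖ :=
    hsw'.congr_ae hae' (ae_of_all _ fun _ => rfl)
  have hwg₁ : HasWeakSpatialGradientOn (slab (EuclideanSpace ℝ (Fin 3)) (Iio 0) isOpen_Iio) v₁ H' :=
    hwg'.congr_ae hae'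
  have hI₁ : typeIBound (Iio (0 : ℝ) ×ˢ univ) v₁ ϖ H' < ⊤ := by
    rw [← typeIBound_congr_ae hae]; exact hI'
  -- the class gradient rate and continuity of the vorticity slices of `v`
  obtain ⟨Kd, -, hgrad⟩ := exists_fderiv_rate_of_class' hdecay hcont hmild
  have hcurl : ∀ t < 0, Continuous (curl (v t)) := fun t ht =>
    continuousOn_univ.1
      (analyticOnNhd_curl (analyticOnNhd_slice hcont (bdd_of_hasTypeITimeDecay hdecay) hmild ht)).continuousOn
  obtain ⟨K, M, hK, -, hKM⟩ := hKM
  obtain ⟨hrate₁, hcont₁, hmild₁, hdiv₁⟩ := hP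
  exact ⟨C, v₁, ϖ, H', ⟨hrate₁, hcont₁, hmild₁, hdiv₁⟩, ⟨hsw₁, hwg₁, hI₁⟩, hsing₁,
    fun s hs y => inner_curl_nonneg_of_profileZoom hnn hzoom hlam s hs y,
    K, hK, fun s hs r hr z => globalCone_of_profileZoom hlam hlam0 hzoom hcurl hgrad hKM s hs r hr z⟩

/-- **Stub credit by name**: the registered stub `stub_zoomToSlackFree : StubZoomToSlackFree` of the skeleton of
record (`ledger skeleton check`, 8 stubs, 2026-08-28T09:50:53Z), under the skeleton's own identifier. -/
theorem stub_zoomToSlackFree : AxisTwistDoorAveragedConeLiouvilleDefs.StubZoomToSlackFree := zoomToSlackFree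

end Summit.NavierStokesRegularity.NavierStokesRegularity.Theorems.AveragedConeLiouvilleProfileZoom

end
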